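import Mathlib.MeasureTheory.Group.ModularCharacter
import Mathlib.MeasureTheory.Measure.Haar.Unique
import Literature.NumberTheory.Automorphic.RankinSelbergLocalTwistProofs
import Literature.NumberTheory.Automorphic.CongruenceSubgroupExpansionGL
import Literature.NumberTheory.Automorphic.PAdicRepsSupercuspidalProofs
import Literature.NumberTheory.Automorphic.HaarConjCompact
import HarnessLib

/-!
# The Gelfand–Kazhdan involution `ι(g) = w⁰ ᵗg w⁰` on `GL_n`, and unimodularity of `GL_n(F)`

Topic `NumberTheory/Automorphic`. Support file (definitions with bodies and proved theorems only;
no named fact) for the Gelfand–Kazhdan criterion of `WhittakerModelsGelfandKazhdan`.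

* `gkInvolution g = w⁰ ᵗg w⁰` — the anti-involution `ι` of `GL_n` of Bump 1997, §4.4, p. 455
  (`ι(g) = w⁰ᵀ g w⁰` there, `(w⁰)ᵀ = w⁰`), written `w⁰ · ᵗ(g⁻¹)⁻¹ · w⁰` with the tree's long Weyl
  element `weylLong n R` (`RankinSelbergLocal`) and transpose-inverse homomorphism
  `GaloisRepresentations.glTransposeInv` (`ContinuousRep`); so `ι(g⁻¹) = w⁰ ᵗg⁻¹ w⁰` is the
  involution `g ↦ w_n g^ι` of the Rankin–Selberg files (`tildeFn`). Entries
  `ι(g)_{ij} = g_{n+1-j,n+1-i}` (`coe_gkInvolution_apply`), `ι(gh) = ι(h) ι(g)`, `ι ∘ ι = id`,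
  `ι(U_n) = U_n` and `ψ_U(ι u) = ψ_U(u)` (`whittakerCharFun_gkInvolution`, from
  `whittakerCharFun_weylLong_conj`; "`ψ_N(ι u) = ψ_N(u)`", Bump, loc. cit.), continuity,
  `gkInvolutionHomeomorph`, and the *automorphism* `gkAutomorphism = (g ↦ ι(g⁻¹))` as a
  `ContinuousMulEquiv` (`glTransposeInvEquiv` is `glTransposeInv` as a `ContinuousMulEquiv`); all of
  this over any commutative (topological) ring `R`.
* `modularCharacter_continuousMulEquiv` — the modular character of a locally compact group is
  invariant under automorphisms of the topological group; `map_eq_self_of_involutive` — a regular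
  Haar measure is invariant under an involutive automorphism.
* `modularCharacter_eq_one_generalLinearGroup`, `isMulRightInvariant_generalLinearGroup` —
  **`GL_n(F)` is unimodular** for a non-archimedean local field `F`. Proof: `Δ` is trivial on the
  compact open `GL_n(𝒪)` (`HaarConjCompact.modularCharacter_eq_one_of_mem_isCompact`),
  `Δ(ᵗd⁻¹) = Δ(d)` forces `Δ(d) = 1` for diagonal `d`, and
  `GL_n(F) = GL_n(𝒪) · {ϖ^a} · GL_n(𝒪)` (Cartan decomposition, `exists_glInt_mul_mul_eq_zpowDiagGL`
  of `CartanDecompositionGLnPowers`). Consequently Haar measure is invariant under `g ↦ ι(g⁻¹)`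
  (`map_gkInvolution_inv_eq_self`, `integral_comp_gkInvolution_inv`).
* `t2Space_generalLinearGroup`, `locallyCompactSpace_generalLinearGroup` — point-set instances for
  `GL_n(F)`, as theorems to be invoked with `haveI` (the convention of `nonarchimedeanGroup_gl`).

Not here: the involution on test functions and distributions (`WhittakerModelsGelfandKazhdan`).

## References

* D. Bump, *Automorphic Forms and Representations* (1997), §4.4, p. 455 (the involution `ι`).
  [Bump1997]
* I. M. Gelfand, D. A. Kazhdan, *Representations of the group GL(n, K) where K is a local field*
  (Budapest 1971; Halsted 1975). [GelfandKazhdan1975]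
* P. Cartier, *Representations of 𝔭-adic groups: a survey*, Corvallis (1979), §IV.2 (Cartan
  decomposition; unimodularity of reductive groups is standard, e.g. Bernstein–Zelevinsky 1976,
  §1). [CartierCorvallis1979]
-/

open Matrix MeasureTheory MeasureTheory.Measure Topology
open scoped MatrixGroups NNReal ENNReal Pointwise

namespace Literature.NumberTheory.Automorphic

section Involution

open GaloisRepresentations (glTransposeInv coe_glTransposeInv_apply)

variable {n : ℕ} {R : Type*} [CommRing R] [TopologicalSpace R]

/-- The matrix of the inverse of `ᵗg⁻¹` is `ᵗg` (for the transpose-inverse homomorphism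
`Literature.NumberTheory.GaloisRepresentations.glTransposeInv` of `ContinuousRep`, reused here).
[folklore] -/
@[simp] lemma coe_glTransposeInv_inv (g : GL (Fin n) R) :
    (((glTransposeInv (Fin n) R g)⁻¹ : GL (Fin n) R) : Matrix (Fin n) (Fin n) R) =
      ((g : GL (Fin n) R) : Matrix (Fin n) (Fin n) R)ᵀ := rfl

variable (n R) in
/-- The transpose-inverse `g ↦ ᵗg⁻¹` as an isomorphism of topological groups
`GL_n(R) ≃ₜ* GL_n(R)`: the continuous homomorphism `GaloisRepresentations.glTransposeInv`, which is
its own inverse (`ᵗ(ᵗg⁻¹)⁻¹ = g`, over any commutative ring). [folklore] -/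
def glTransposeInvEquiv : GL (Fin n) R ≃ₜ* GL (Fin n) R where
  toFun := glTransposeInv (Fin n) R
  invFun := glTransposeInv (Fin n) R
  left_inv g := Units.ext (by
    rw [coe_glTransposeInv_apply, ← map_inv, coe_glTransposeInv_apply, inv_inv, Matrix.transpose_transpose])
  right_inv g := Units.ext (by
    rw [coe_glTransposeInv_apply, ← map_inv, coe_glTransposeInv_apply, inv_inv, Matrix.transpose_transpose])
  map_mul' := map_mul _
  continuous_toFun := (glTransposeInv (Fin n) R).continuous_toFun
  continuous_invFun := (glTransposeInv (Fin n) R).continuous_toFun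

/-- `glTransposeInvEquiv` is `glTransposeInv` as a function. [folklore] -/
@[simp] lemma glTransposeInvEquiv_apply (g : GL (Fin n) R) :
    glTransposeInvEquiv n R g = glTransposeInv (Fin n) R g := rfl

/-- The **Gelfand–Kazhdan involution** `ι(g) = w⁰ ᵗg w⁰` of `GL_n(R)`, `w⁰ = weylLong n R` the
long Weyl element (Bump 1997, §4.4, p. 455: an anti-automorphism of order two preserving `U_n` and
its generic character). Written as `w⁰ · ᵗ(g⁻¹)⁻¹ · w⁰` through the tree's
`GaloisRepresentations.glTransposeInv`. [cite: Bump1997, §4.4, p. 455] -/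
def gkInvolution (g : GL (Fin n) R) : GL (Fin n) R :=
  weylLong n R * glTransposeInv (Fin n) R g⁻¹ * weylLong n R

/-- Entries of `ι(g)`: `ι(g)_{ij} = g_{n+1-j, n+1-i}`. [folklore] -/
lemma coe_gkInvolution_apply (g : GL (Fin n) R) (i j : Fin n) :
    ((gkInvolution g : GL (Fin n) R) : Matrix (Fin n) (Fin n) R) i j =
      (g : Matrix (Fin n) (Fin n) R) (Fin.rev j) (Fin.rev i) := by
  rw [gkInvolution, Units.val_mul, Units.val_mul, weylLong_mul_mul_weylLong_apply,
    coe_glTransposeInv_apply, inv_inv, Matrix.transpose_apply]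

/-- `ι` is an anti-automorphism: `ι(g h) = ι(h) ι(g)`. [folklore] -/
lemma gkInvolution_mul (g h : GL (Fin n) R) :
    gkInvolution (g * h) = gkInvolution h * gkInvolution g := by
  apply Units.ext
  ext i j
  rw [Units.val_mul, Matrix.mul_apply, coe_gkInvolution_apply, Units.val_mul, Matrix.mul_apply]
  rw [← Equiv.sum_comp Fin.revPerm]
  refine Finset.sum_congr rfl fun k _ => ?_
  simp only [coe_gkInvolution_apply, Fin.revPerm_apply]
  ring

/-- `ι(1) = 1`. [folklore] -/
@[simp] lemma gkInvolution_one : gkInvolution (1 : GL (Fin n) R) = 1 := by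
  rw [gkInvolution, inv_one, map_one, mul_one, weylLong_mul_self]

/-- `ι` is an involution. [folklore] -/
@[simp] lemma gkInvolution_gkInvolution (g : GL (Fin n) R) : gkInvolution (gkInvolution g) = g := by
  apply Units.ext
  ext i j
  rw [coe_gkInvolution_apply, coe_gkInvolution_apply, Fin.rev_rev, Fin.rev_rev]

/-- `ι(g⁻¹) = ι(g)⁻¹`. [folklore] -/
lemma gkInvolution_inv (g : GL (Fin n) R) : gkInvolution g⁻¹ = (gkInvolution g)⁻¹ := by
  apply eq_inv_of_mul_eq_one_left
  rw [← gkInvolution_mul, mul_inv_cancel, gkInvolution_one]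

/-- `ι(g⁻¹) = w⁰ ᵗg⁻¹ w⁰`: the composite of `ι` with inversion is the conjugate by `w⁰` of the
transpose-inverse (an automorphism). [folklore] -/
lemma gkInvolution_inv_eq (g : GL (Fin n) R) :
    gkInvolution g⁻¹ = weylLong n R * glTransposeInv (Fin n) R g * weylLong n R := by
  rw [gkInvolution, inv_inv]

/-- `ι` preserves the upper unitriangular group `U_n`
(`weylLong_mul_glTransposeInv_mul_weylLong_mem` of `RankinSelbergLocalProofs`, at `u⁻¹`).
[folklore] -/
lemma gkInvolution_mem_upperUnitriangular {u : GL (Fin n) R}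
    (hu : u ∈ upperUnitriangular (Fin n) R) : gkInvolution u ∈ upperUnitriangular (Fin n) R :=
  weylLong_mul_glTransposeInv_mul_weylLong_mem ((upperUnitriangular (Fin n) R).inv_mem hu)

/-- `ψ_U(ι u) = ψ_U(u)` (Bump 1997, §4.4, p. 455: "`ψ_N(ι u) = ψ_N(u)` for `u ∈ N(F)`"); from
`whittakerCharFun_weylLong_conj` (`ψ_U(w⁰ ᵗv⁻¹ w⁰) = ψ⁻¹_U(v)`) at `v = u⁻¹`.
[cite: Bump1997, §4.4, p. 455] -/
lemma whittakerCharFun_gkInvolution (ψ : AddChar R Circle) (u : ↥(upperUnitriangular (Fin n) R)) :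
    whittakerCharFun ψ ⟨gkInvolution (u : GL (Fin n) R), gkInvolution_mem_upperUnitriangular u.2⟩ =
      whittakerCharFun ψ u := by
  have h := whittakerCharFun_weylLong_conj ψ u⁻¹
  rw [whittakerCharFun_apply ψ⁻¹, superdiagSum_inv, AddChar.inv_apply, neg_neg,
    ← whittakerCharFun_apply] at h
  exact h

omit [TopologicalSpace R] in
/-- `ψ_U(u⁻¹) = ψ_U(u)⁻¹`. [folklore] -/
lemma whittakerCharFun_inv_eq_inv (ψ : AddChar R Circle) (u : ↥(upperUnitriangular (Fin n) R)) :
    whittakerCharFun ψ u⁻¹ = (whittakerCharFun ψ u)⁻¹ := by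
  apply eq_inv_of_mul_eq_one_left
  rw [← whittakerCharFun_mul, inv_mul_cancel, whittakerCharFun_one]

variable [IsTopologicalRing R]

/-- `ι` is continuous. [folklore] -/
lemma continuous_gkInvolution : Continuous (gkInvolution : GL (Fin n) R → GL (Fin n) R) :=
  (continuous_const.mul ((glTransposeInv (Fin n) R).continuous_toFun.comp continuous_inv)).mul
    continuous_const

/-- `ι` as a homeomorphism of `GL_n(R)`. [folklore] -/
def gkInvolutionHomeomorph : GL (Fin n) R ≃ₜ GL (Fin n) R where
  toFun := gkInvolution
  invFun := gkInvolution
  left_inv := gkInvolution_gkInvolution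
  right_inv := gkInvolution_gkInvolution
  continuous_toFun := continuous_gkInvolution
  continuous_invFun := continuous_gkInvolution

/-- The automorphism `τ(g) = ι(g⁻¹) = w⁰ ᵗg⁻¹ w⁰` of the topological group `GL_n(R)`:
transpose-inverse followed by conjugation by `w⁰`. [folklore] -/
def gkAutomorphism : GL (Fin n) R ≃ₜ* GL (Fin n) R :=
  (glTransposeInvEquiv n R).trans
    { MulAut.conj (weylLong n R) with
      continuous_toFun := (continuous_const.mul continuous_id).mul continuous_const
      continuous_invFun := (continuous_const.mul continuous_id).mul continuous_const }

/-- `τ(g) = ι(g⁻¹)`. [folklore] -/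
lemma gkAutomorphism_apply (g : GL (Fin n) R) : gkAutomorphism g = gkInvolution g⁻¹ := by
  change weylLong n R * glTransposeInv (Fin n) R g * (weylLong n R)⁻¹ = _
  rw [weylLong_inv, gkInvolution_inv_eq]

end Involution

/-! ### Haar measure on `GL_n(F)`: unimodularity and invariance under the Gelfand–Kazhdan maps -/

section ModularCharacter

variable {G : Type*} [Group G] [TopologicalSpace G] [IsTopologicalGroup G] [LocallyCompactSpace G]

/-- The modular character is invariant under automorphisms of the topological group `G`:
`Δ(e g) = Δ(g)` (transport the defining Haar measure along `e`). [folklore] -/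
theorem modularCharacter_continuousMulEquiv (e : G ≃ₜ* G) (g : G) :
    modularCharacter (e g) = modularCharacter g := by
  borelize G
  set μ : Measure G := MeasureTheory.Measure.haar
  have hm : Measurable (e.symm : G → G) := e.symm.continuous.measurable
  haveI : IsHaarMeasure (Measure.map e.symm μ) := e.symm.isHaarMeasure_map μ
  change modularCharacterFun (e g) = modularCharacterFun g
  rw [modularCharacterFun_eq_haarScalarFactor μ (e g),
    modularCharacterFun_eq_haarScalarFactor (Measure.map e.symm μ) g,
    ← haarScalarFactor_map (Measure.map (· * e g) μ) μ e.symm]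
  congr 1
  rw [Measure.map_map hm (measurable_mul_const _), Measure.map_map (measurable_mul_const _) hm]
  congr 1
  funext x
  simp only [Function.comp_apply, map_mul, ContinuousMulEquiv.symm_apply_apply]

/-- A Haar measure is invariant under an **involutive** automorphism `e` of the topological
group (`e ∘ e = id`): `e_* μ = c μ` by uniqueness and `c² = 1`. [folklore] -/
theorem map_eq_self_of_involutive {G : Type*} [Group G] [TopologicalSpace G] [IsTopologicalGroup G]
    [LocallyCompactSpace G] [MeasurableSpace G] [BorelSpace G] (μ : Measure G) [IsHaarMeasure μ]
    [μ.Regular] (e : G ≃ₜ* G) (he : Function.Involutive e) : Measure.map e μ = μ := by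
  have hm : Measurable (e : G → G) := e.continuous.measurable
  haveI : (Measure.map e μ).Regular := Measure.Regular.map (e : G ≃ₜ G)
  haveI : IsHaarMeasure (Measure.map e μ) := e.isHaarMeasure_map μ
  let c : ℝ≥0∞ := haarScalarFactor (Measure.map e μ) μ
  have hc : Measure.map e μ = c • μ := isMulLeftInvariant_eq_smul_of_regular _ μ
  have h2 : Measure.map e (Measure.map e μ) = c ^ 2 • μ := by
    rw [hc, Measure.map_smul, hc, smul_smul, pow_two]
  have hμ : μ = c ^ 2 • μ := by
    rw [Measure.map_map hm hm, he.comp_self, Measure.map_id] at h2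
    exact h2
  have K : TopologicalSpace.PositiveCompacts G := Classical.arbitrary _
  have h1 : c ^ 2 * μ K = 1 ^ 2 * μ K := by
    conv_rhs => rw [hμ]
    simp
  have hcc : c ^ 2 = 1 ^ 2 :=
    (ENNReal.mul_left_inj (measure_pos_of_nonempty_interior _ K.interior_nonempty).ne'
      K.isCompact.measure_lt_top.ne).1 h1
  have hc1 : c = 1 := (ENNReal.pow_right_strictMono two_ne_zero).injective hcc
  rw [hc, hc1, one_smul]

end ModularCharacter

section LocalField

open GaloisRepresentations (glTransposeInv coe_glTransposeInv_apply)

variable {F : Type*} [Field F] [ValuativeRel F] [TopologicalSpace F] [IsNonarchimedeanLocalField F]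
  (n : ℕ)

variable (F) in
/-- `GL_n(F)` is Hausdorff for a non-archimedean local field `F`. [folklore] -/
theorem t2Space_generalLinearGroup : T2Space (GL (Fin n) F) := by
  haveI : T2Space F := (GaloisRepresentations.IsNonarchimedeanLocalField.isLocalField F).toT2Space
  infer_instance

variable (F) in
/-- `GL_n(F)` is locally compact for a non-archimedean local field `F` (closed in
`M_n(F) × M_n(F)ᵐᵒᵖ` under `g ↦ (g, g⁻¹)`). [folklore] -/
theorem locallyCompactSpace_generalLinearGroup : LocallyCompactSpace (GL (Fin n) F) := by
  haveI : T2Space F := (GaloisRepresentations.IsNonarchimedeanLocalField.isLocalField F).toT2Space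
  haveI : LocallyCompactSpace (Matrix (Fin n) (Fin n) F) :=
    inferInstanceAs (LocallyCompactSpace (Fin n → Fin n → F))
  haveI : LocallyCompactSpace (Matrix (Fin n) (Fin n) F)ᵐᵒᵖ :=
    MulOpposite.opHomeomorph.symm.isClosedEmbedding.locallyCompactSpace
  exact Units.isClosedEmbedding_embedProduct.locallyCompactSpace

-- Local instances only: point-set facts about `GL_n(F)` that this tree proves as theorems (no
-- Mathlib instance exists for them); `modularCharacter`/`haar` need them at statement level.
attribute [local instance] t2Space_generalLinearGroup locallyCompactSpace_generalLinearGroup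
  nonarchimedeanGroup_gl sigmaCompactSpace_generalLinearGroup

variable {n}

omit [ValuativeRel F] [IsNonarchimedeanLocalField F] in
/-- The transpose-inverse of a diagonal torus element `ϖ^a` is its inverse. [folklore] -/
lemma glTransposeInv_zpowDiagGL {ϖ : F} (hϖ : ϖ ≠ 0) (a : Fin n → ℤ) :
    glTransposeInv (Fin n) F (zpowDiagGL hϖ a) = (zpowDiagGL hϖ a)⁻¹ := by
  apply Units.ext
  rw [coe_glTransposeInv_apply, ← zpowDiagGL_neg, coe_zpowDiagGL, Matrix.diagonal_transpose]

/-- **`GL_n(F)` is unimodular**: the modular character of `GL_n(F)` is trivial. Proof: `Δ` is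
trivial on the compact open `GL_n(𝒪)`; `Δ(ᵗg⁻¹) = Δ(g)` (`modularCharacter_continuousMulEquiv`)
gives `Δ(d) = Δ(d)⁻¹`, so `Δ(d) = 1`, for diagonal `d`; conclude by the Cartan decomposition
`g = k₁ ϖ^a k₂`. (Bump 1997, §4.2; Bernstein–Zelevinsky 1976, §1; the standard statement is
"reductive `p`-adic groups are unimodular".) [folklore] -/
theorem modularCharacter_eq_one_generalLinearGroup (g : GL (Fin n) F) : modularCharacter g = 1 := by
  borelize (GL (Fin n) F)
  obtain ⟨ϖ, hϖ⟩ := exists_isUniformizingElement (F := F)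
  have hK : ∀ k ∈ glInt n F, modularCharacter k = 1 := fun k hk =>
    modularCharacter_eq_one_of_mem_isCompact (isCompact_glInt n F) hk
  have hD : ∀ a : Fin n → ℤ, modularCharacter (zpowDiagGL hϖ.ne_zero a) = 1 := by
    intro a
    have h := modularCharacter_continuousMulEquiv (glTransposeInvEquiv n F)
      (zpowDiagGL hϖ.ne_zero a)
    rw [glTransposeInvEquiv_apply, glTransposeInv_zpowDiagGL, map_inv] at h
    have hpos : 0 < modularCharacter (zpowDiagGL hϖ.ne_zero a) := modularCharacterFun_pos _
    have hsq : modularCharacter (zpowDiagGL hϖ.ne_zero a) * modularCharacter (zpowDiagGL hϖ.ne_zero a)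
        = 1 := by
      nth_rewrite 1 [← h]
      exact inv_mul_cancel₀ hpos.ne'
    rcases le_total (modularCharacter (zpowDiagGL hϖ.ne_zero a)) 1 with h1 | h1
    · nlinarith [mul_le_mul h1 h1 hpos.le zero_le_one]
    · nlinarith [mul_le_mul h1 h1 zero_le_one hpos.le]
  obtain ⟨k₁, hk₁, k₂, hk₂, a, -, hg⟩ := exists_glInt_mul_mul_eq_zpowDiagGL hϖ g
  have : g = k₁⁻¹ * zpowDiagGL hϖ.ne_zero a * k₂⁻¹ := by rw [← hg]; group
  rw [this, map_mul, map_mul, hK _ (inv_mem hk₁), hK _ (inv_mem hk₂), hD, one_mul, one_mul]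

variable [MeasurableSpace (GL (Fin n) F)] [BorelSpace (GL (Fin n) F)]

/-- **Unimodularity of `GL_n(F)`**: every inner regular (e.g. regular) Haar measure on `GL_n(F)`
is right invariant. [folklore] -/
theorem isMulRightInvariant_generalLinearGroup (μ : Measure (GL (Fin n) F)) [IsHaarMeasure μ]
    [μ.InnerRegular] : μ.IsMulRightInvariant := by
  refine ⟨fun g => ?_⟩
  rw [map_right_mul_eq_modularCharacterFun_smul μ g]
  change (modularCharacter g) • μ = μ
  rw [modularCharacter_eq_one_generalLinearGroup, one_smul]

/-- A regular Haar measure on `GL_n(F)` is invariant under the automorphism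
`τ(g) = ι(g⁻¹) = w⁰ ᵗg⁻¹ w⁰`. [folklore] -/
theorem map_gkInvolution_inv_eq_self (μ : Measure (GL (Fin n) F)) [IsHaarMeasure μ] [μ.Regular] :
    Measure.map (fun g : GL (Fin n) F => gkInvolution g⁻¹) μ = μ := by
  have h : (fun g : GL (Fin n) F => gkInvolution g⁻¹) = (gkAutomorphism (n := n) (R := F)) :=
    funext fun g => (gkAutomorphism_apply g).symm
  rw [h]
  exact map_eq_self_of_involutive μ _ fun g => by
    simp only [gkAutomorphism_apply, gkInvolution_inv, inv_inv, gkInvolution_gkInvolution]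

/-- Change of variables `g ↦ ι(g⁻¹)` in a Haar integral on `GL_n(F)`. [folklore] -/
theorem integral_comp_gkInvolution_inv (μ : Measure (GL (Fin n) F)) [IsHaarMeasure μ] [μ.Regular]
    (f : GL (Fin n) F → ℂ) : ∫ g, f (gkInvolution g⁻¹) ∂μ = ∫ g, f g ∂μ := by
  set e : GL (Fin n) F ≃ᵐ GL (Fin n) F :=
    ((gkAutomorphism (n := n) (R := F) : GL (Fin n) F ≃ₜ GL (Fin n) F)).toMeasurableEquiv
  have he : (e : GL (Fin n) F → GL (Fin n) F) = fun g => gkInvolution g⁻¹ := by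
    funext g
    exact gkAutomorphism_apply g
  have h := MeasureTheory.integral_map_equiv (μ := μ) e f
  rw [he, map_gkInvolution_inv_eq_self] at h
  exact h.symm

end LocalField

end Literature.NumberTheory.Automorphic
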